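import Summits.KontsevichZagierPeriods.KontsevichZagierPeriods.Theorems.SymplecticScissorsPlanarTransport
import Summits.KontsevichZagierPeriods.KontsevichZagierPeriods.Theorems.AbelContractionRealArcKernelSplit

/-!
# KontsevichZagierPeriods / AbelContraction — trust-base audit of the crux `RealArcKernel`
# (item stmt-KontsevichZagierPeriods-12472; support file of lead c6, line `dimtwo_redirect`)

The crux `RealArcKernel` (the kernel conjecture of the KZ calculus enlarged by the one-curve real
hyperelliptic sector) carries on the ledger the summit-equivalence witness
`RealArcKernelStrength.realArcKernel_iff_kontsevichZagierPeriods`, which is conditional on the OPEN item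
`PlanarAreas` (stmt-4990). This file re-bases that witness on the PUBLISHED theorem it actually rests on and
records, kernel-checked, how the crux sits against its two split children (the registered stubs of the lead
skeleton, items stmt-4280 `KZDimTwo` and stmt-18030 `ReductionToDimensionTwo`):

* `realArcKernel_iff_kontsevichZagierPeriods_of_huberWustholz` — modulo the cite-only named fact
  `HuberWustholzCurvePeriods` (Huber–Wüstholz 2022, Thm. 13.3 (2), through the landed transfer
  `SymplecticScissors.PlanarTransport.planarAreas_of_huberWustholzCurvePeriods`) the crux IS the summit;
* `kontsevichZagierPeriods_iff_kzDimTwo_and_reductionToDimensionTwo` — UNCONDITIONALLY the summit is exactly the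
  conjunction of the two children (the split of the crux loses nothing and over-shoots nothing);
* `realArcKernel_iff_reductionToDimensionTwo` — given the stratum `KZDimTwo`, the crux IS the child
  `ReductionToDimensionTwo` (unconditional; `→` does not even need the stratum);
* `kzDimTwo_of_realArcKernel_of_huberWustholz`, `realArcKernel_iff_subs_of_huberWustholz` — modulo the same
  published fact the first child is necessary too, so the crux is EXACTLY `KZDimTwo ∧ ReductionToDimensionTwo`.

So the honest reading of the node is: `RealArcKernel ≡ KontsevichZagierPeriods ≡ KZDimTwo ∧ ReductionToDimensionTwo`
modulo one published theorem, with `ReductionToDimensionTwo` necessary outright. Everything here is composition of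
landed results (`RealArcKernelStrength`, `RealArcKernelSplit`, `PlanarTransport`); deliberately NOT here: any attack
on the children themselves (open problems with their own items and lines).

Sources: M. Kontsevich, D. Zagier, *Periods* (2001), §1.2 Conjecture 1; A. Huber, G. Wüstholz,
*Transcendence and linear relations of 1-periods* (2022), Thm. 13.3 (2); A. Huber, S. Müller-Stach (2017), Ch. 13.
-/

noncomputable section

open Literature.NumberTheory.Transcendental
open Summit.KontsevichZagierPeriods.KontsevichZagierPeriods.Theses.AbelContraction
  (RealArcKernel PlanarAreas KZDimTwo ReductionToDimensionTwo)

namespace Summit.KontsevichZagierPeriods.AbelContraction.RealArcKernelAudit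

/-- **The crux is the summit modulo Huber–Wüstholz.** Assuming the published theorem
`HuberWustholzCurvePeriods` (Huber–Wüstholz 2022, Thm. 13.3 (2): all `ℚ̄`-linear relations among 1-periods of
curve type come from bilinearity and functoriality), `RealArcKernel ↔ KontsevichZagierPeriods`: the fact gives
`PlanarAreas` (landed transfer `planarAreas_of_huberWustholzCurvePeriods`), under which the landed
`realArcKernel_iff_kontsevichZagierPeriods` applies. [cite: HuberWustholz2022, Thm. 13.3 (2)] -/
theorem realArcKernel_iff_kontsevichZagierPeriods_of_huberWustholz (hHW : HuberWustholzCurvePeriods) :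
    Summit.KontsevichZagierPeriods.KontsevichZagierPeriods.Theses.AbelContraction.RealArcKernel ↔
      KontsevichZagierPeriods :=
  Summit.KontsevichZagierPeriods.AbelContraction.RealArcKernelStrength.realArcKernel_iff_kontsevichZagierPeriods
    (Summit.KontsevichZagierPeriods.SymplecticScissors.PlanarTransport.planarAreas_of_huberWustholzCurvePeriods hHW)

/-- **The split is lossless, unconditionally**: the summit is EXACTLY the conjunction of the two children of the
crux, `KontsevichZagierPeriods ↔ KZDimTwo ∧ ReductionToDimensionTwo` (`→`: both children are consequences of the
summit, `RealArcKernelSplit.kzDimTwo_of_kontsevichZagierPeriods` / `…reductionToDimensionTwo_of_kontsevichZagierPeriods`;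
`←`: `RealArcKernelSplit.kontsevichZagierPeriods_of_subs`). [cite: KontsevichZagier2001, §1.2 Conjecture 1] -/
theorem kontsevichZagierPeriods_iff_kzDimTwo_and_reductionToDimensionTwo :
    KontsevichZagierPeriods ↔
      (Summit.KontsevichZagierPeriods.KontsevichZagierPeriods.Theses.AbelContraction.KZDimTwo ∧
        Summit.KontsevichZagierPeriods.KontsevichZagierPeriods.Theses.AbelContraction.ReductionToDimensionTwo) :=
  ⟨fun h =>
    ⟨Summit.KontsevichZagierPeriods.AbelContraction.RealArcKernelSplit.kzDimTwo_of_kontsevichZagierPeriods h,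
      Summit.KontsevichZagierPeriods.AbelContraction.RealArcKernelSplit.reductionToDimensionTwo_of_kontsevichZagierPeriods
        h⟩,
    fun h => Summit.KontsevichZagierPeriods.AbelContraction.RealArcKernelSplit.kontsevichZagierPeriods_of_subs h.1 h.2⟩

/-- **Given the stratum, the crux IS its second child** (unconditional): `KZDimTwo → (RealArcKernel ↔
ReductionToDimensionTwo)`. The direction `→` holds outright (`reductionToDimensionTwo_of_realArcKernel`: the
child is NECESSARY); `←` is the landed split glue `realArcKernel_of_subs` fed with the stratum. This is the
precise sense in which the crux is blocked on item stmt-18030 once stmt-4280 is granted.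
[cite: KontsevichZagier2001, §1.2 Conjecture 1] -/
theorem realArcKernel_iff_reductionToDimensionTwo
    (h₂ : Summit.KontsevichZagierPeriods.KontsevichZagierPeriods.Theses.AbelContraction.KZDimTwo) :
    Summit.KontsevichZagierPeriods.KontsevichZagierPeriods.Theses.AbelContraction.RealArcKernel ↔
      Summit.KontsevichZagierPeriods.KontsevichZagierPeriods.Theses.AbelContraction.ReductionToDimensionTwo :=
  ⟨Summit.KontsevichZagierPeriods.AbelContraction.RealArcKernelSplit.reductionToDimensionTwo_of_realArcKernel,
    Summit.KontsevichZagierPeriods.AbelContraction.RealArcKernelSplit.realArcKernel_of_subs h₂⟩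

/-- **The first child is necessary modulo Huber–Wüstholz**: assuming `HuberWustholzCurvePeriods`,
`RealArcKernel → KZDimTwo` (through the summit). Without the published fact only the second child is known
to be necessary. [cite: HuberWustholz2022, Thm. 13.3 (2)] -/
theorem kzDimTwo_of_realArcKernel_of_huberWustholz (hHW : HuberWustholzCurvePeriods)
    (h : Summit.KontsevichZagierPeriods.KontsevichZagierPeriods.Theses.AbelContraction.RealArcKernel) :
    Summit.KontsevichZagierPeriods.KontsevichZagierPeriods.Theses.AbelContraction.KZDimTwo :=
  Summit.KontsevichZagierPeriods.AbelContraction.RealArcKernelSplit.kzDimTwo_of_kontsevichZagierPeriods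
    ((realArcKernel_iff_kontsevichZagierPeriods_of_huberWustholz hHW).mp h)

/-- **The crux is EXACTLY its two children modulo Huber–Wüstholz**: assuming `HuberWustholzCurvePeriods`,
`RealArcKernel ↔ KZDimTwo ∧ ReductionToDimensionTwo` — the registered stubs of the lead skeleton
(`Cruxes/RealArcKernel/Lines/dimtwo_redirect.lean`) are jointly equivalent to the crux, not merely sufficient.
[cite: HuberWustholz2022, Thm. 13.3 (2)] -/
theorem realArcKernel_iff_subs_of_huberWustholz (hHW : HuberWustholzCurvePeriods) :
    Summit.KontsevichZagierPeriods.KontsevichZagierPeriods.Theses.AbelContraction.RealArcKernel ↔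
      (Summit.KontsevichZagierPeriods.KontsevichZagierPeriods.Theses.AbelContraction.KZDimTwo ∧
        Summit.KontsevichZagierPeriods.KontsevichZagierPeriods.Theses.AbelContraction.ReductionToDimensionTwo) :=
  (realArcKernel_iff_kontsevichZagierPeriods_of_huberWustholz hHW).trans
    kontsevichZagierPeriods_iff_kzDimTwo_and_reductionToDimensionTwo

end Summit.KontsevichZagierPeriods.AbelContraction.RealArcKernelAudit

end
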